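import Summits.ABC.IUTFork.Conditional.AbcOfSHwBadMDeepOfLinUniformTable
import Summits.ABC.IUTFork.Conditional.AbcOfSGenuineKTameRobustRows1
import Summits.ABC.IUTFork.Conditional.AbcOfSHwindowFreyRefutationEleven
import Summits.ABC.IUTFork.Conditional.AbcOfSHwindowFreyRefutationSeventeen
import Summits.ABC.IUTFork.Conditional.AbcOfSHwindowFreyRefutationP6
import HarnessLib

/-!
# Branch C, M line — the §N/§P datum is M-DEEP: at the tier-1 Frey–Legendre datum `λ = 2·5¹⁰·13⁴/(11⁸·109²·3677³)`
# (abc triple `2·5¹⁰·13⁴ + 3¹⁵·7·31⁷·45817 = 11⁸·109²·3677³`), `l ∈ {11, 13, 17}`, EVERY genuine Θ-volume datum has an M-deep member over `31`,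
# so the M apex socket's shallowness input is FALSE there — UNCONDITIONALLY (the non-emptiness comes from the (P6) THEOREM p476875)

C scoreboard (abc-iut-C-cert-3 gen 4, INTAKE / CERTS pen). PROOF-ONLY junction file (no `def`, no new `Prop`, no instance, no notation; nothing
re-typed). WHY THIS FILE: on the K line the window binder `hSHwBad` (p453137) / `hSHw` (p447945) is now FALSE with NO hypothesis at
`(ratPoint λ, 13)` (abc-iut-w6-d102 gen 4: `condP6_thirteen` p476875 + `not_hSHwBad_frey_holds`); the books must say what the SAME datum does to the
M window family (`abc_of_SH_v11M_window_szpiroBadAll` p453767 → θ-cut p461893). This seat's M socket `not_hSHwBad_M_of_refuted` (p468391 §1) fires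
only if EVERY genuine datum over the pair is M-SHALLOW (its input `hshallow`). Here that input is REFUTED at the tier-1 datum for all three primes:
over the place `31` (`31⁷ ∥ b`, pole order `14`) abc-iut-w5-d107's local-type-uniform depth witness — exported by this seat as
`GenuineM.exists_deep_triple_of_linUniform` (p472279) — passes its integer test at the top label (`l = 13`: `26·442 = 11492 ≤ 14·35·29 = 14210`;
`l = 11`: `8426 ≤ 9744`; `l = 17`: `19040 ≤ 25578`; `B = 1`: `30·l < 31·30`).

* `FreyTier1.exists_deepM` — for `l = 11 ∨ 13 ∨ 17` and EVERY `T : ThetaVolumeDatumAt (ratPoint λ) l`: some `(u, i, x₀)` is M-deep (the `∃`-clause whose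
  negation is the depth antecedent of the M window binders p445989 / p453767 / p461893, VERBATIM as in p470379 / p472279).
* `FreyTier1.not_forall_shallowM` — hence the socket input «every genuine datum over `(ratPoint λ, l)` is M-shallow» is FALSE as soon as the datum
  type is inhabited;
* `FreyTier1.not_forall_shallowM_thirteen / _eleven / _seventeen` — and it IS inhabited, with NO hypothesis: `ThetaPartII.stub_thetaData` at the
  admissible pair (abc-iut-w6-d102's `FreyTier1.nonempty_thetaVolumeDatumAt` / `…_eleven` / `…_seventeen`) fed with the (P6) THEOREMS
  `condP6_thirteen / _eleven / _seventeen` (p476875, fact-free Frobenius certificate at `29` + Tate transvection at `7`).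

CONSEQUENCE FOR THE BOOKS (numbers, no side): the §P event has NO M twin through the window binder — at `(λ_3677, 11 | 13 | 17)` the M certificates
engage their NUMBER binder `hNumBad_M` (deep locus), never `hSHwBad_M`; together with p470379 / p472279 (all [LIN] / harvest rows) and abc-iut-W-ref-1's
p476143 (15 of 16 tame-exact instances) NO refuted (datum, l) in the tree engages the M window binder, and at the one datum where the K window binder
is refuted outright the M one is provably unengaged. The M window family therefore stays LIVE-UNENGAGED (neither refuted nor instantiated at known
data); this is a statement about OUR sharp M setting's explicit `(d, a, b)` depth form, not about print.

HONEST FRAMING: nothing here asserts that abc is proved or refuted, or that [IUTchIII] Cor. 3.12 / Thm. 3.11 or [IUTchIV] Thm. 1.10 holds or fails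
at any datum, or takes a side on any author (Mochizuki / Scholze–Stix / Joshi / Dupuy–Hilado); typed ≠ proved; instantiated ≠ endorsed; a junction
discharges nothing. [cite: Mochizuki2012, IUTchIII Cor. 3.12 Step (xi-f) p. 184; IUTchIV Prop. 1.2 (i)(ii) p. 10, Thm. 1.10 proof Steps (ii)–(iii)
p. 24–26, Cor. 2.2 (ii) proof (P5)(P6)(P7) p. 44–46] [claim: Mochizuki2012, status: disputed] for every IUT sentence quoted.
-/

noncomputable section

open Set Function NumberField IsDedekindDomain

namespace Summit.ABC.IUTFork.Conditional

open Thm311 Thm311.Real Cor312 Cor312Vol Cor312Prov Literature.IUT.LogThetaLattice Literature.IUT.LogVolume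
  Literature.IUT.HodgeTheaters Literature.IUT.LogVolume.ThetaData Literature.IUT.LogVolume.Cor22
open Literature.NumberTheory.NumberFields Literature.NumberTheory.GaloisRepresentations.Ultrametric
open Literature.NumberTheory.DiophantineGeometry Literature.NumberTheory.DiophantineGeometry.GenEll Summit.ABC.ABC.Theorems

/-- **The tier-1 datum is M-DEEP at `l ∈ {11, 13, 17}`**: for EVERY genuine Θ-volume datum `T` over `(ratPoint λ_3677, l)` there is an M-deep
`(u, i, x₀)` — witnessed over the place `31` (`31⁷ ∥ 3¹⁵·7·31⁷·45817`, `B = 1`, top label `i₀ + 1 = (l−1)/2`), by this seat's export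
`GenuineM.exists_deep_triple_of_linUniform` (p472279) of abc-iut-w5-d107's depth witness. The `∃`-clause is the NEGATION of the depth antecedent of the
M window binders (p445989 / p453767 / p461893) VERBATIM. [cite: Mochizuki2012, IUTchIV Prop. 1.2 (i)(ii) p. 10, Cor. 2.2 (ii) proof (P5) p. 46]
[claim: Mochizuki2012, status: disputed] -/
theorem FreyTier1.exists_deepM {l : ℕ} (hl : l = 11 ∨ l = 13 ∨ l = 17)
    (T : Cor22.ThetaVolumeDatumAt (ratPoint (((2 * 5 ^ 10 * 13 ^ 4 : ℕ) : ℚ) / (11 ^ 8 * 109 ^ 2 * 3677 ^ 3 : ℕ))) l) :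
    letI := T.instFieldF; letI := T.instNumberFieldF; letI := T.instAlgebraF; letI := T.instFieldK
    letI := T.instNumberFieldK; letI := T.instAlgebraK; letI := T.instFieldFbar; letI := T.instAlgebraFbar
    letI := T.instAlgebraKFbar; letI := T.instIsElliptic
    ∃ (u : FinitePlace ℚ) (i : Fin (thetaIndexOfInitial T.D).lstar) (x₀ : (thetaIndexOfInitial T.D).Fibre (Val.non u)),
        ((ratChar u : ℕ) : ℝ) ^ ((((i : ℕ) : ℝ) + 2) *
        (differentOrd (ratChar u) (kOfM T.D (ratChar u) u (natCast_ratChar_mem u) x₀)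
        + logRadiusA (ratChar u) (absRamificationIdx (ratChar u) (kOfM T.D (ratChar u) u (natCast_ratChar_mem u) x₀))
        + logRadiusB (ratChar u) (absRamificationIdx (ratChar u) (kOfM T.D (ratChar u) u (natCast_ratChar_mem u) x₀))) + 1) *
        ‖tqM T.D (ratChar u) u (natCast_ratChar_mem u) (ideleDataOf T.D T.isVolumeInputOf) x₀‖ ^ (((i : ℕ) + 1) ^ 2 - 1) < 1 := by
  have hu : ratChar (placeOfPrimeQ 31 (by norm_num)) = 31 := ratChar_placeOfPrimeQ 31 (by norm_num)
  rcases hl with rfl | rfl | rfl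
  · exact GenuineM.exists_deep_triple_of_linUniform isABCTriple_3677 T (placeOfPrimeQ 31 (by norm_num)) (by rw [hu]; norm_num)
      (by rw [hu]; norm_num) (by rw [hu]; norm_num) (by rw [hu]; norm_num) 1 (by rw [hu]; norm_num) 7 (by norm_num)
      (by rw [hu]; norm_num) 4 (by norm_num) (by rw [hu]; norm_num)
  · exact GenuineM.exists_deep_triple_of_linUniform isABCTriple_3677 T (placeOfPrimeQ 31 (by norm_num)) (by rw [hu]; norm_num)
      (by rw [hu]; norm_num) (by rw [hu]; norm_num) (by rw [hu]; norm_num) 1 (by rw [hu]; norm_num) 7 (by norm_num)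
      (by rw [hu]; norm_num) 5 (by norm_num) (by rw [hu]; norm_num)
  · exact GenuineM.exists_deep_triple_of_linUniform isABCTriple_3677 T (placeOfPrimeQ 31 (by norm_num)) (by rw [hu]; norm_num)
      (by rw [hu]; norm_num) (by rw [hu]; norm_num) (by rw [hu]; norm_num) 1 (by rw [hu]; norm_num) 7 (by norm_num)
      (by rw [hu]; norm_num) 7 (by norm_num) (by rw [hu]; norm_num)

/-- **The M socket's shallowness input is FALSE at the tier-1 datum whenever the datum type is inhabited** (`l ∈ {11, 13, 17}`): the hypothesis
`hshallow` of `not_hSHwBad_M_of_refuted` (p468391 §1) — «every genuine datum over the pair is M-shallow» — contradicts `FreyTier1.exists_deepM`.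
Pure logic. [cite: Mochizuki2012, IUTchIII Cor. 3.12 Step (xi-f) p. 184] [claim: Mochizuki2012, status: disputed] -/
theorem FreyTier1.not_forall_shallowM {l : ℕ} (hl : l = 11 ∨ l = 13 ∨ l = 17)
    (hne : Nonempty (Cor22.ThetaVolumeDatumAt (ratPoint (((2 * 5 ^ 10 * 13 ^ 4 : ℕ) : ℚ) / (11 ^ 8 * 109 ^ 2 * 3677 ^ 3 : ℕ))) l)) :
    ¬ (∀ T : Cor22.ThetaVolumeDatumAt (ratPoint (((2 * 5 ^ 10 * 13 ^ 4 : ℕ) : ℚ) / (11 ^ 8 * 109 ^ 2 * 3677 ^ 3 : ℕ))) l,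
      letI := T.instFieldF; letI := T.instNumberFieldF; letI := T.instAlgebraF; letI := T.instFieldK
      letI := T.instNumberFieldK; letI := T.instAlgebraK; letI := T.instFieldFbar; letI := T.instAlgebraFbar
      letI := T.instAlgebraKFbar; letI := T.instIsElliptic
      ¬ (∃ (u : FinitePlace ℚ) (i : Fin (thetaIndexOfInitial T.D).lstar) (x₀ : (thetaIndexOfInitial T.D).Fibre (Val.non u)),
        ((ratChar u : ℕ) : ℝ) ^ ((((i : ℕ) : ℝ) + 2) *
        (differentOrd (ratChar u) (kOfM T.D (ratChar u) u (natCast_ratChar_mem u) x₀)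
        + logRadiusA (ratChar u) (absRamificationIdx (ratChar u) (kOfM T.D (ratChar u) u (natCast_ratChar_mem u) x₀))
        + logRadiusB (ratChar u) (absRamificationIdx (ratChar u) (kOfM T.D (ratChar u) u (natCast_ratChar_mem u) x₀))) + 1) *
        ‖tqM T.D (ratChar u) u (natCast_ratChar_mem u) (ideleDataOf T.D T.isVolumeInputOf) x₀‖ ^ (((i : ℕ) + 1) ^ 2 - 1) < 1)) := by
  intro hshallow
  obtain ⟨T⟩ := hne
  exact hshallow T (FreyTier1.exists_deepM hl T)

/-- **UNCONDITIONAL at `l = 13` (the §N/§P datum)**: the datum type over `(ratPoint λ_3677, 13)` is inhabited by abc-iut-w6-d102's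
`FreyTier1.nonempty_thetaVolumeDatumAt` at the (P6) THEOREM `condP6_thirteen` (p476875), so «every genuine datum is M-shallow» is FALSE with NO
hypothesis: the M window binder is NOT engaged at the datum where the K window binder is refuted outright.
[cite: Mochizuki2012, IUTchIV Cor. 2.2 (ii) proof (P6)(P7) p. 46] [claim: Mochizuki2012, status: disputed] -/
theorem FreyTier1.not_forall_shallowM_thirteen :
    ¬ (∀ T : Cor22.ThetaVolumeDatumAt (ratPoint (((2 * 5 ^ 10 * 13 ^ 4 : ℕ) : ℚ) / (11 ^ 8 * 109 ^ 2 * 3677 ^ 3 : ℕ))) 13,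
      letI := T.instFieldF; letI := T.instNumberFieldF; letI := T.instAlgebraF; letI := T.instFieldK
      letI := T.instNumberFieldK; letI := T.instAlgebraK; letI := T.instFieldFbar; letI := T.instAlgebraFbar
      letI := T.instAlgebraKFbar; letI := T.instIsElliptic
      ¬ (∃ (u : FinitePlace ℚ) (i : Fin (thetaIndexOfInitial T.D).lstar) (x₀ : (thetaIndexOfInitial T.D).Fibre (Val.non u)),
        ((ratChar u : ℕ) : ℝ) ^ ((((i : ℕ) : ℝ) + 2) *
        (differentOrd (ratChar u) (kOfM T.D (ratChar u) u (natCast_ratChar_mem u) x₀)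
        + logRadiusA (ratChar u) (absRamificationIdx (ratChar u) (kOfM T.D (ratChar u) u (natCast_ratChar_mem u) x₀))
        + logRadiusB (ratChar u) (absRamificationIdx (ratChar u) (kOfM T.D (ratChar u) u (natCast_ratChar_mem u) x₀))) + 1) *
        ‖tqM T.D (ratChar u) u (natCast_ratChar_mem u) (ideleDataOf T.D T.isVolumeInputOf) x₀‖ ^ (((i : ℕ) + 1) ^ 2 - 1) < 1)) :=
  FreyTier1.not_forall_shallowM (Or.inr (Or.inl rfl)) (FreyTier1.nonempty_thetaVolumeDatumAt condP6_thirteen)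

/-- **UNCONDITIONAL at `l = 11`** (non-emptiness: abc-iut-w6-d102's `FreyTier1.nonempty_thetaVolumeDatumAt_eleven` at `condP6_eleven`, p476875).
[cite: Mochizuki2012, IUTchIV Cor. 2.2 (ii) proof (P6)(P7) p. 46] [claim: Mochizuki2012, status: disputed] -/
theorem FreyTier1.not_forall_shallowM_eleven :
    ¬ (∀ T : Cor22.ThetaVolumeDatumAt (ratPoint (((2 * 5 ^ 10 * 13 ^ 4 : ℕ) : ℚ) / (11 ^ 8 * 109 ^ 2 * 3677 ^ 3 : ℕ))) 11,
      letI := T.instFieldF; letI := T.instNumberFieldF; letI := T.instAlgebraF; letI := T.instFieldK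
      letI := T.instNumberFieldK; letI := T.instAlgebraK; letI := T.instFieldFbar; letI := T.instAlgebraFbar
      letI := T.instAlgebraKFbar; letI := T.instIsElliptic
      ¬ (∃ (u : FinitePlace ℚ) (i : Fin (thetaIndexOfInitial T.D).lstar) (x₀ : (thetaIndexOfInitial T.D).Fibre (Val.non u)),
        ((ratChar u : ℕ) : ℝ) ^ ((((i : ℕ) : ℝ) + 2) *
        (differentOrd (ratChar u) (kOfM T.D (ratChar u) u (natCast_ratChar_mem u) x₀)
        + logRadiusA (ratChar u) (absRamificationIdx (ratChar u) (kOfM T.D (ratChar u) u (natCast_ratChar_mem u) x₀))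
        + logRadiusB (ratChar u) (absRamificationIdx (ratChar u) (kOfM T.D (ratChar u) u (natCast_ratChar_mem u) x₀))) + 1) *
        ‖tqM T.D (ratChar u) u (natCast_ratChar_mem u) (ideleDataOf T.D T.isVolumeInputOf) x₀‖ ^ (((i : ℕ) + 1) ^ 2 - 1) < 1)) :=
  FreyTier1.not_forall_shallowM (Or.inl rfl) (FreyTier1.nonempty_thetaVolumeDatumAt_eleven condP6_eleven)

/-- **UNCONDITIONAL at `l = 17`** (non-emptiness: abc-iut-w6-d102's `FreyTier1.nonempty_thetaVolumeDatumAt_seventeen` at `condP6_seventeen`, p476875).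
[cite: Mochizuki2012, IUTchIV Cor. 2.2 (ii) proof (P6)(P7) p. 46] [claim: Mochizuki2012, status: disputed] -/
theorem FreyTier1.not_forall_shallowM_seventeen :
    ¬ (∀ T : Cor22.ThetaVolumeDatumAt (ratPoint (((2 * 5 ^ 10 * 13 ^ 4 : ℕ) : ℚ) / (11 ^ 8 * 109 ^ 2 * 3677 ^ 3 : ℕ))) 17,
      letI := T.instFieldF; letI := T.instNumberFieldF; letI := T.instAlgebraF; letI := T.instFieldK
      letI := T.instNumberFieldK; letI := T.instAlgebraK; letI := T.instFieldFbar; letI := T.instAlgebraFbar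
      letI := T.instAlgebraKFbar; letI := T.instIsElliptic
      ¬ (∃ (u : FinitePlace ℚ) (i : Fin (thetaIndexOfInitial T.D).lstar) (x₀ : (thetaIndexOfInitial T.D).Fibre (Val.non u)),
        ((ratChar u : ℕ) : ℝ) ^ ((((i : ℕ) : ℝ) + 2) *
        (differentOrd (ratChar u) (kOfM T.D (ratChar u) u (natCast_ratChar_mem u) x₀)
        + logRadiusA (ratChar u) (absRamificationIdx (ratChar u) (kOfM T.D (ratChar u) u (natCast_ratChar_mem u) x₀))
        + logRadiusB (ratChar u) (absRamificationIdx (ratChar u) (kOfM T.D (ratChar u) u (natCast_ratChar_mem u) x₀))) + 1) *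
        ‖tqM T.D (ratChar u) u (natCast_ratChar_mem u) (ideleDataOf T.D T.isVolumeInputOf) x₀‖ ^ (((i : ℕ) + 1) ^ 2 - 1) < 1)) :=
  FreyTier1.not_forall_shallowM (Or.inr (Or.inr rfl)) (FreyTier1.nonempty_thetaVolumeDatumAt_seventeen condP6_seventeen)

end Summit.ABC.IUTFork.Conditional

end
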